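import Summits.PneNP.PneNP.Theorems.ChebyshevTracialDesignDimTwoDenseCellHomogeneous
import Summits.PneNP.PneNP.Theorems.ChebyshevTracialDesignHomogeneousRounding
import HarnessLib

/-!
# Cell pnp-psdrank, route `ChebyshevTracialDesign`, brick 65: WEIGHTED quantitative spectral non-tightness (SNT-q)_w —
# a dense cut weight and a homogeneous-dense matching WEIGHT always have an active tight pair (mod Keevash–Lifshitz)

The one analytic input left open by bricks 61–63 (`…DimTwoSynchronisation`, `…DimTwoDenseCell`, `…DimTwoDenseCellHomogeneous`: the
`r = 2` dense non-crossing psd cell without a net) and by `…GeneralPositionBudget` (eng g13) was the hypothesis `hSNTw` / `hSNT`: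
«for `x : t`-cuts `→ [0,1]` of mass `≥ ε·#t-cuts` and `z : PM_n → [0,1]` whose weight is `(PM_n, τ)`-homogeneous (Kupavskii–Zakharov,
`IsRelHomogeneousW`) of mass `≥ ν·#PM_n` there are `U, M` with `cc(U,M) = 1`, `x_U > 0`, `z_M > 0`» (MEMO-14 §5 (d)(1)/(h) of the cell).
For SETS (indicator weights) this is the tree's `snt_sym_oddSet_of_globalLevelD` (brick 29: spectral non-tightness of dense × homogeneous
pairs, mod `GlobalLevelDInequality` = [cite: KeevashLifshitz2023, Thm. 1.8], itself now derived from Keller–Lifshitz–Marcus via the tree's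
`GlobalLevelDInequality_of_klm`). THIS FILE proves the weighted form from the set form by ROUNDING (brick 64,
`…HomogeneousRounding.exists_homogeneous_subfamily`): a `(PM_n, τ)`-homogeneous `[0,1]`-weight of density `ν` contains, in its support, a
`(PM_n, 4τ)`-homogeneous SET of density `≥ ν/2`, because every nonempty star of a partial matching `S` with `s` edges has
`τ^s·pm(n − 2s) ≥ 2^{n/2−1}` members — exponentially more than the `≈ n²·log 2` demanded by the union bound — as soon as `τ ≥ 2`.
* §1 counting: `two_pow_le_pmCount` (`2^{k−1} ≤ pm(2k)`), `two_pow_le_pow_mul_card_supersets`, `eight_mul_dq_le`, the numerical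
  `poly_le_two_pow`, and the threshold bookkeeping `two_mul_exp_le_exp_half`, `half_pow_le_exp_neg_half`.
* §2 `weightedSNT_of_globalLevelD` — (SNT-q)_w for every homogeneity parameter `τ ≥ 2`, thresholds `ε, ν ≥ exp(−c₀·dq n)`.
* §3 `weightedSNT_subweights_of_globalLevelD` — the SUB-WEIGHT form consumed by `…GeneralPositionBudget` / `…KernelPileUp`
  (`x' ≤ x` of mass `≥ θ`, `z' ≤ z` carrying half of `z`), via brick 59's `isRelHomogeneousW_of_le_of_half`.
* §4 `denseCell_dim_two_of_globalLevelD` — brick 63 with its hypothesis DISCHARGED: the `r = 2` dense non-crossing psd cell is a theorem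
  modulo `GlobalLevelDInequality` alone (value `≤ 6γ + 4·B_v·ε` for every tight psd pair of dimension `2` with `(PM, e)`-homogeneous trace
  weight of density `≥ 4ν`, `ε, ν ≥ exp(−c₀ dq n)`, given the `r = 1` rung `TracialValueLEAt W γ 1`).
[cite: KupavskiiZakharov2022, §2] [cite: KeevashLifshitz2023, Thm. 1.8] [cite: Rothvoss2017, §2 (PDF p. 6)] [cite: AlonSpencer2016, Appendix A.1]
Stature: support/instrument (kernel theorems, no defs; conditional on `GlobalLevelDInequality` exactly like the `r = 1` rung).
WHAT THIS IS NOT: not the dense cell for `r > 2`, nothing on psd rank of `P_PM(K_n)`, no P-vs-NP content. Supports stmt-PneNP-19878.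
-/

set_option linter.dupNamespace false -- `Summit.PneNP.PneNP.…`: summit = sub-problem (D-0017)

noncomputable section

namespace Summit.PneNP.PneNP.Theorems.ChebyshevTracialDesignWeightedSNT

open Finset Matrix Literature.Barriers.PneNP Literature.Combinatorics.Optimization
open Literature.Combinatorics.SetFamily
open Literature.Combinatorics.AssociationSchemes.HomogeneousMatchingFamilies (isPMOn_verts image_val_subset)
open Literature.Combinatorics.Additive.KeevashLifshitz (GlobalLevelDInequality)
open Summit.PneNP.PneNP.Theorems.ChebyshevTracialDesignSpectralNonTightnessWide (snt_sym_oddSet_of_globalLevelD)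
open Summit.PneNP.PneNP.Theorems.ChebyshevTracialDesignRungCells (card_tcuts_eq_choose)
open Summit.PneNP.PneNP.Theorems.ChebyshevTracialDesignRungPieces (card_supersets_perfectMatchings_eq)
open Summit.PneNP.PneNP.Theorems.ChebyshevTracialDesignClosedPairCount (succ_mul_pmCount pmCount_two)
open Summit.PneNP.PneNP.Theorems.ChebyshevTracialDesignDipoleHitRatio (card_pmatch_eq_pmCount)
open Summit.PneNP.PneNP.Theorems.ChebyshevTracialDesignSynchronisationTools (isRelHomogeneousW_of_le_of_half)
open Summit.PneNP.PneNP.Theorems.ChebyshevTracialDesignHomogeneousRounding (exists_homogeneous_subfamily)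
open Summit.PneNP.PneNP.Theorems.ChebyshevTracialDesignDimTwoDenseCellHomogeneous (wmass_ext_eq_sum denseCell_dim_two_of_homogeneous)

variable {n : ℕ}

/-! ### §1 Counting: stars of partial matchings are exponentially large; thresholds -/

/-- `2^{k−1} ≤ pm(2k)`: the number of perfect matchings of `K_{2k}` is at least `2^{k−1}` (`pm(2k+2) = (2k+1)·pm(2k)`). [folklore] -/
theorem two_pow_le_pmCount : ∀ k : ℕ, 2 ^ (k - 1) ≤ pmCount (2 * k)
  | 0 => by rw [Nat.mul_zero, pmCount_zero]; norm_num
  | 1 => by rw [Nat.mul_one, pmCount_two]; norm_num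
  | k + 2 => by
    have ih := two_pow_le_pmCount (k + 1)
    have e : 2 * (k + 2) = 2 * (k + 1) + 2 := by ring
    rw [e, ← succ_mul_pmCount, show k + 2 - 1 = (k + 1 - 1) + 1 by omega, pow_succ]
    calc 2 ^ (k + 1 - 1) * 2 ≤ pmCount (2 * (k + 1)) * (2 * (k + 1) + 1) := Nat.mul_le_mul ih (by omega)
      _ = (2 * (k + 1) + 1) * pmCount (2 * (k + 1)) := Nat.mul_comm _ _

/-- **Stars are exponentially large.** For `n` even, `τ ≥ 2` and an edge set `S` with a nonempty star among the perfect matchings of `K_n`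
(so `S` is a partial matching with `s` edges and the star has `pm(n − 2s)` members): `2^{n/2 − 1} ≤ τ^s · |{M : S ⊆ M}|`.
[cite: KupavskiiZakharov2022, §2 (the star 𝒜(S))] -/
theorem two_pow_le_pow_mul_card_supersets (hn : Even n) {τ : ℝ} (hτ : 2 ≤ τ) {S : Finset (Sym2 (Fin n))}
    (hS : (supersets (perfectMatchings (univ : Finset (Fin n))) S).Nonempty) :
    (2 : ℝ) ^ (n / 2 - 1) ≤ τ ^ #S * #(supersets (perfectMatchings (univ : Finset (Fin n))) S) := by
  obtain ⟨M, hM⟩ := hS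
  rw [mem_supersets, mem_perfectMatchings] at hM
  have hpm := isPMOn_verts hM.1 hM.2
  rw [card_supersets_perfectMatchings_eq hpm]
  have h2 := hpm.two_mul_card
  have hle : #(Literature.Combinatorics.AssociationSchemes.HomogeneousMatchingFamilies.verts S) ≤ n := by
    simpa using card_le_univ (Literature.Combinatorics.AssociationSchemes.HomogeneousMatchingFamilies.verts S)
  obtain ⟨k₀, hk₀⟩ := hn
  obtain ⟨k, hk⟩ : ∃ k : ℕ, n - #(Literature.Combinatorics.AssociationSchemes.HomogeneousMatchingFamilies.verts S) = 2 * k :=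
    ⟨k₀ - #S, by omega⟩
  rw [hk]
  have h1 : (2 : ℝ) ^ (k - 1) ≤ pmCount (2 * k) := by exact_mod_cast two_pow_le_pmCount k
  have h3 : (2 : ℝ) ^ #S ≤ τ ^ #S := pow_le_pow_left₀ (by norm_num) hτ _
  have h4 : n / 2 - 1 ≤ #S + (k - 1) := by omega
  calc (2 : ℝ) ^ (n / 2 - 1) ≤ 2 ^ (#S + (k - 1)) := pow_le_pow_right₀ (by norm_num) h4
    _ = 2 ^ #S * 2 ^ (k - 1) := pow_add _ _ _
    _ ≤ τ ^ #S * pmCount (2 * k) := mul_le_mul h3 h1 (by positivity) (by positivity)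

/-- `8·dq n ≤ n` for `n ≥ 8` (`dq n = ⌊⌊√n⌋^{1/2}⌋`, so `(dq n)^4 ≤ n`). [folklore] -/
theorem eight_mul_dq_le (hn : 8 ≤ n) : 8 * dq n ≤ n := by
  have h4 : dq n ^ 4 ≤ n := by
    have h1 : dq n * dq n ≤ Nat.sqrt n := Nat.sqrt_le (Nat.sqrt n)
    calc dq n ^ 4 = (dq n * dq n) * (dq n * dq n) := by ring
      _ ≤ Nat.sqrt n * Nat.sqrt n := Nat.mul_le_mul h1 h1
      _ ≤ n := Nat.sqrt_le n
  rcases Nat.lt_or_ge (dq n) 2 with h | h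
  · omega
  · have h8 : 8 ≤ dq n ^ 3 := by
      calc 8 = 2 ^ 3 := by norm_num
        _ ≤ dq n ^ 3 := Nat.pow_le_pow_left h 3
    calc 8 * dq n ≤ dq n ^ 3 * dq n := Nat.mul_le_mul_right _ h8
      _ = dq n ^ 4 := by ring
      _ ≤ n := h4

/-- `8(j+1)² + 3(j+1) + 10 ≤ 2^j` for `j ≥ 10`. [folklore] -/
theorem poly_le_two_pow {j : ℕ} (hj : 10 ≤ j) : 8 * (j + 1) ^ 2 + 3 * (j + 1) + 10 ≤ 2 ^ j := by
  induction j, hj using Nat.le_induction with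
  | base => norm_num
  | succ k hk ih =>
    have h1 : 8 * (k + 1 + 1) ^ 2 + 3 * (k + 1 + 1) + 10 ≤ 2 * (8 * (k + 1) ^ 2 + 3 * (k + 1) + 10) := by nlinarith
    calc 8 * (k + 1 + 1) ^ 2 + 3 * (k + 1 + 1) + 10 ≤ 2 * (8 * (k + 1) ^ 2 + 3 * (k + 1) + 10) := h1
      _ ≤ 2 * 2 ^ k := Nat.mul_le_mul_left _ ih
      _ = 2 ^ (k + 1) := by rw [pow_succ]; ring

/-- **The union bound is affordable**: for even `n ≥ 32`, `n(n+1) + 10 ≤ 2^{n/2 − 1 − dq n}`. [folklore] -/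
theorem quad_le_two_pow_sub (hev : Even n) (hn : 32 ≤ n) : n * (n + 1) + 10 ≤ 2 ^ (n / 2 - 1 - dq n) := by
  have h8 := eight_mul_dq_le (le_trans (by norm_num) hn)
  obtain ⟨k, hk⟩ := hev
  set j := n / 2 - 1 - dq n with hj
  have h3 : 3 * n ≤ 8 * (j + 1) := by omega
  have hj10 : 10 ≤ j := by omega
  have hpoly := poly_le_two_pow hj10
  have h1 : n * (n + 1) + 10 ≤ 8 * (j + 1) ^ 2 + 3 * (j + 1) + 10 := by nlinarith
  exact h1.trans hpoly

/-- `2·|Sym2 (Fin n)| + 10 = n(n+1) + 10`. [folklore] -/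
theorem two_mul_card_sym2_add : 2 * Fintype.card (Sym2 (Fin n)) + 10 = n * (n + 1) + 10 := by
  have hc : Fintype.card (Sym2 (Fin n)) = (n + 1).choose (1 + 1) := by rw [Sym2.card, Fintype.card_fin]
  have h := Nat.add_one_mul_choose_eq n 1
  rw [Nat.choose_one_right] at h
  have h' : n * (n + 1) = (n + 1).choose (1 + 1) * (1 + 1) := by rw [mul_comm n (n + 1)]; exact h
  rw [hc, h']
  ring

/-- Threshold bookkeeping: once `c·dq n ≥ 2`, `2·exp(−c·dq n) ≤ exp(−(c/2)·dq n)`; this holds for `n ≥ ⌈2/c⌉^4`. [folklore] -/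
theorem two_mul_exp_le_exp_half {c : ℝ} (hc : 0 < c) :
    ∃ n₀ : ℕ, ∀ n : ℕ, n₀ ≤ n → 2 * Real.exp (-(c * dq n)) ≤ Real.exp (-(c / 2 * dq n)) := by
  refine ⟨⌈2 / c⌉₊ ^ 4, fun n hn => ?_⟩
  have hD : ⌈2 / c⌉₊ ≤ dq n := by
    unfold dq
    rw [Nat.le_sqrt, Nat.le_sqrt]
    calc ⌈2 / c⌉₊ * ⌈2 / c⌉₊ * (⌈2 / c⌉₊ * ⌈2 / c⌉₊) = ⌈2 / c⌉₊ ^ 4 := by ring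
      _ ≤ n := hn
  have hcD : 2 ≤ c * dq n := by
    have h1 : 2 / c ≤ (dq n : ℝ) := (Nat.le_ceil _).trans (by exact_mod_cast hD)
    rwa [div_le_iff₀ hc, mul_comm] at h1
  have h2 : (2 : ℝ) ≤ Real.exp (c / 2 * dq n) := by
    have := Real.add_one_le_exp (c / 2 * dq n)
    linarith
  have h3 : Real.exp (-(c * dq n)) = Real.exp (-(c / 2 * dq n)) * Real.exp (-(c / 2 * dq n)) := by
    rw [← Real.exp_add]; ring_nf
  rw [h3]
  have h4 : Real.exp (-(c / 2 * dq n)) ≤ 1 / 2 := by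
    rw [Real.exp_neg, inv_eq_one_div, div_le_div_iff₀ (Real.exp_pos _) two_pos]
    linarith
  have h5 := Real.exp_pos (-(c / 2 * dq n))
  nlinarith

/-- `(1/2)^d ≤ exp(−d/2)` (since `e^{1/2} ≤ 2`). [folklore] -/
theorem half_pow_le_exp_neg_half (d : ℕ) : (1 / 2 : ℝ) ^ d ≤ Real.exp (-((1 / 2 : ℝ) * d)) := by
  have he : Real.exp (1 / 2 : ℝ) ≤ 2 := by
    by_contra h
    rw [not_le] at h
    have h2 : (4 : ℝ) < Real.exp (1 / 2) * Real.exp (1 / 2) := by nlinarith [Real.exp_pos (1 / 2 : ℝ)]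
    rw [← Real.exp_add, show (1 / 2 : ℝ) + 1 / 2 = 1 by norm_num] at h2
    have := Real.exp_one_lt_d9
    linarith
  have h1 : (1 / 2 : ℝ) ≤ Real.exp (-(1 / 2 : ℝ)) := by
    rw [Real.exp_neg, inv_eq_one_div, div_le_div_iff₀ two_pos (Real.exp_pos _)]
    linarith
  calc (1 / 2 : ℝ) ^ d ≤ (Real.exp (-(1 / 2 : ℝ))) ^ d := pow_le_pow_left₀ (by norm_num) h1 d
    _ = Real.exp (-((1 / 2 : ℝ) * d)) := by rw [← Real.exp_nat_mul]; ring_nf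

/-! ### §2 The weighted quantitative spectral non-tightness -/

/-- **(SNT-q)_w — WEIGHTED SPECTRAL NON-TIGHTNESS (mod Keevash–Lifshitz Thm 1.8).** Assume `GlobalLevelDInequality` and fix a homogeneity
parameter `τ ≥ 2`. There are `c₀ > 0` and `n₁` such that for every even `n ≥ n₁`, odd `t` with `n ≤ 5t`, `n ≤ 5(n − t)`, and thresholds
`ε, ν ≥ exp(−c₀·dq n)`: whenever `x : OddSet n → [0,1]` vanishes off the `t`-cuts and has mass `≥ ε·#t-cuts`, and `z : PM_n → [0,1]` is a
weight whose edge-set extension is `(PM_n, τ)`-homogeneous (Kupavskii–Zakharov) with mass `≥ ν·#PM_n`, there is an ACTIVE TIGHT PAIR: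
`cc(U, M) = 1`, `x_U > 0`, `z_M > 0`. Proof: round `z` to a `(PM_n, 4τ)`-homogeneous set of density `≥ ν/2` inside its support (brick 64;
the stars have `τ^s·pm(n−2s) ≥ 2^{n/2−1}` members), take the support of `x` (density `≥ ε`), and apply the set version
`snt_sym_oddSet_of_globalLevelD` at parameter `4τ`. [cite: KeevashLifshitz2023, Thm. 1.8] [cite: KupavskiiZakharov2022, §2]
[cite: AlonSpencer2016, Appendix A.1] -/
theorem weightedSNT_of_globalLevelD (hKL : GlobalLevelDInequality) {τ : ℝ} (hτ : 2 ≤ τ) :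
    ∃ c₀ : ℝ, 0 < c₀ ∧ ∃ n₁ : ℕ, ∀ (n t : ℕ), n₁ ≤ n → Even n → Odd t → n ≤ 5 * t → n ≤ 5 * (n - t) →
      ∀ (ε ν : ℝ), Real.exp (-(c₀ * dq n)) ≤ ε → Real.exp (-(c₀ * dq n)) ≤ ν →
      ∀ (x : OddSet n → ℝ) (z : PMatch n → ℝ), (∀ U, 0 ≤ x U ∧ x U ≤ 1) → (∀ U, U.1.card ≠ t → x U = 0) →
      ε * ((univ.filter fun U : OddSet n => U.1.card = t).card : ℝ) ≤ ∑ U, x U → (∀ M, 0 ≤ z M ∧ z M ≤ 1) →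
      IsRelHomogeneousW τ (perfectMatchings (univ : Finset (Fin n)))
        (fun M : Finset (Sym2 (Fin n)) => if hM : IsPMOn (univ : Finset (Fin n)) M then z ⟨M, hM⟩ else 0)
        ((univ : Finset (PMatch n)).image Subtype.val) →
      ν * (Fintype.card (PMatch n) : ℝ) ≤ ∑ M, z M → ∃ U M, cc U M = 1 ∧ 0 < x U ∧ 0 < z M := by
  classical
  have hτ4 : (1 : ℝ) ≤ 4 * τ := by linarith
  obtain ⟨c₁, hc₁, N₁, hS⟩ := snt_sym_oddSet_of_globalLevelD hKL hτ4
  obtain ⟨N₂, hN₂⟩ := two_mul_exp_le_exp_half hc₁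
  set c₀ : ℝ := min (c₁ / 2) (1 / 2) with hc₀_def
  have hc₀ : 0 < c₀ := lt_min (by positivity) (by norm_num)
  have hc₀c₁ : c₀ ≤ c₁ / 2 := min_le_left _ _
  have hc₀h : c₀ ≤ 1 / 2 := min_le_right _ _
  refine ⟨c₀, hc₀, max N₁ (max N₂ 32), ?_⟩
  intro n t hn hev hto h5 h5' ε ν hε hν x z hx hxt hxm hz hzh hzm
  have hN₁ : N₁ ≤ n := le_trans (le_max_left _ _) hn
  have hN₂n : N₂ ≤ n := le_trans ((le_max_left _ _).trans (le_max_right _ _)) hn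
  have h32 : 32 ≤ n := le_trans ((le_max_right _ _).trans (le_max_right _ _)) hn
  have hdq0 : (0 : ℝ) ≤ dq n := Nat.cast_nonneg _
  -- thresholds
  have hmono₁ : Real.exp (-(c₁ * dq n)) ≤ Real.exp (-(c₀ * dq n)) :=
    Real.exp_le_exp.2 (by nlinarith)
  have hmono₂ : Real.exp (-(c₁ / 2 * dq n)) ≤ Real.exp (-(c₀ * dq n)) :=
    Real.exp_le_exp.2 (by nlinarith)
  have hmono₃ : Real.exp (-((1 / 2 : ℝ) * dq n)) ≤ Real.exp (-(c₀ * dq n)) :=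
    Real.exp_le_exp.2 (by nlinarith)
  have hν2 : Real.exp (-(c₁ * dq n)) ≤ ν / 2 := by
    have := hN₂ n hN₂n
    linarith [hmono₂.trans hν]
  have hνhalf : (1 / 2 : ℝ) ^ dq n ≤ ν := ((half_pow_le_exp_neg_half (dq n)).trans hmono₃).trans hν
  have hν0 : 0 < ν := lt_of_lt_of_le (by positivity) hνhalf
  -- (1) the cut side: the support of `x`
  have htn : t < n := by omega
  set X : Finset (OddSet n) := univ.filter fun U => 0 < x U with hX_def
  have hXt : ∀ U ∈ X, U.1.card = t := fun U hU => by
    by_contra h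
    have := (mem_filter.1 hU).2
    rw [hxt U h] at this
    exact lt_irrefl _ this
  have hXcard : ∑ U, x U ≤ (X.card : ℝ) := by
    rw [← sum_filter_add_sum_filter_not univ (fun U : OddSet n => 0 < x U)]
    have h0 : ∑ U ∈ univ.filter (fun U : OddSet n => ¬0 < x U), x U = 0 :=
      sum_eq_zero fun U hU => le_antisymm (not_lt.1 (mem_filter.1 hU).2) (hx U).1
    rw [h0, add_zero]
    calc ∑ U ∈ X, x U ≤ ∑ _U ∈ X, (1 : ℝ) := sum_le_sum fun U _ => (hx U).2
      _ = X.card := by rw [sum_const, nsmul_eq_mul, mul_one]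
  have hchoose : (0 : ℝ) < (n.choose t : ℝ) := by exact_mod_cast Nat.choose_pos htn.le
  have hdX : Real.exp (-(c₁ * dq n)) ≤ (X.card : ℝ) / (n.choose t : ℝ) := by
    rw [le_div_iff₀ hchoose]
    rw [card_tcuts_eq_choose hto] at hxm
    calc Real.exp (-(c₁ * dq n)) * (n.choose t : ℝ) ≤ ε * (n.choose t : ℝ) :=
          mul_le_mul_of_nonneg_right (hmono₁.trans hε) hchoose.le
      _ ≤ X.card := hxm.trans hXcard
  -- (2) the matching side: round the weight to a homogeneous set
  set 𝒜 : Finset (Finset (Sym2 (Fin n))) := perfectMatchings (univ : Finset (Fin n)) with h𝒜_def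
  set ℱ : Finset (Finset (Sym2 (Fin n))) := (univ : Finset (PMatch n)).image Subtype.val with hℱ_def
  set zx : Finset (Sym2 (Fin n)) → ℝ :=
    fun M => if hM : IsPMOn (univ : Finset (Fin n)) M then z ⟨M, hM⟩ else 0 with hzx_def
  have hℱ𝒜 : ℱ ⊆ 𝒜 := image_val_subset _
  have hzx : ∀ A, 0 ≤ zx A ∧ zx A ≤ 1 := fun A => by
    by_cases hA : IsPMOn (univ : Finset (Fin n)) A
    · simp only [hzx_def, hA, dif_pos]; exact hz _
    · simp only [hzx_def, hA, dif_neg, not_false_eq_true, le_refl, zero_le_one, and_self]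
  have hmass : wmass zx ℱ = ∑ M, z M := wmass_ext_eq_sum z
  have hcardA : (#𝒜 : ℝ) = Fintype.card (PMatch n) := by rw [card_pmatch_eq_pmCount, pmCount]
  have hApos : (0 : ℝ) < #𝒜 := by
    rw [hcardA]
    exact_mod_cast Fintype.card_pos_iff.2 ⟨Classical.choice (by
      rw [← Fintype.card_pos_iff, card_pmatch_eq_pmCount]; exact pmCount_pos hev)⟩
  -- every nonempty star is heavy
  have hΛ : ∀ S : Finset (Sym2 (Fin n)), (supersets 𝒜 S).Nonempty →
      (2 * Fintype.card (Sym2 (Fin n)) + 10 : ℝ) * #𝒜 ≤ τ ^ #S * #(supersets 𝒜 S) * wmass zx ℱ := by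
    intro S hSne
    have hstar := two_pow_le_pow_mul_card_supersets hev hτ hSne
    have hq : ((n * (n + 1) + 10 : ℕ) : ℝ) ≤ ((2 ^ (n / 2 - 1 - dq n) : ℕ) : ℝ) := by
      exact_mod_cast quad_le_two_pow_sub hev h32
    have hK : (2 * Fintype.card (Sym2 (Fin n)) + 10 : ℝ) = ((n * (n + 1) + 10 : ℕ) : ℝ) := by
      rw [← two_mul_card_sym2_add]; push_cast; ring
    have hdqle : dq n ≤ n / 2 - 1 := by have := eight_mul_dq_le (le_trans (by norm_num) h32); omega
    have hsplit : (2 : ℝ) ^ (n / 2 - 1) = 2 ^ (n / 2 - 1 - dq n) * 2 ^ dq n := by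
      rw [← pow_add, Nat.sub_add_cancel hdqle]
    have hpow2 : ((2 ^ (n / 2 - 1 - dq n) : ℕ) : ℝ) * 1 ≤ (2 : ℝ) ^ (n / 2 - 1) * ν := by
      rw [hsplit, mul_assoc]
      push_cast
      refine mul_le_mul_of_nonneg_left ?_ (by positivity)
      calc (1 : ℝ) = 2 ^ dq n * (1 / 2) ^ dq n := by rw [← mul_pow]; norm_num
        _ ≤ 2 ^ dq n * ν := mul_le_mul_of_nonneg_left hνhalf (by positivity)
    have hm : ν * #𝒜 ≤ wmass zx ℱ := by rw [hmass, hcardA]; exact hzm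
    calc (2 * Fintype.card (Sym2 (Fin n)) + 10 : ℝ) * #𝒜
        ≤ ((2 ^ (n / 2 - 1 - dq n) : ℕ) : ℝ) * 1 * #𝒜 := by
          rw [hK, mul_one]; exact mul_le_mul_of_nonneg_right hq hApos.le
      _ ≤ (2 : ℝ) ^ (n / 2 - 1) * ν * #𝒜 := mul_le_mul_of_nonneg_right hpow2 hApos.le
      _ ≤ τ ^ #S * #(supersets 𝒜 S) * ν * #𝒜 :=
          mul_le_mul_of_nonneg_right (mul_le_mul_of_nonneg_right hstar hν0.le) hApos.le
      _ = τ ^ #S * #(supersets 𝒜 S) * (ν * #𝒜) := by ring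
      _ ≤ τ ^ #S * #(supersets 𝒜 S) * wmass zx ℱ := mul_le_mul_of_nonneg_left hm (by positivity)
  obtain ⟨𝒢, h𝒢ℱ, h𝒢pos, h𝒢hom, h𝒢mass⟩ := exists_homogeneous_subfamily (by linarith) hℱ𝒜 hzx hzh hΛ
  -- back to `PMatch` currency
  set Y' : Finset (PMatch n) := univ.filter fun M => M.1 ∈ 𝒢 with hY'_def
  have hY'img : Y'.image Subtype.val = 𝒢 := by
    ext A
    simp only [mem_image, mem_filter, mem_univ, true_and, hY'_def]
    constructor
    · rintro ⟨M, hM, rfl⟩; exact hM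
    · intro hA
      obtain ⟨M, -, rfl⟩ := mem_image.1 (h𝒢ℱ hA)
      exact ⟨M, hA, rfl⟩
  have hY'card : (Y'.card : ℝ) = #𝒢 := by
    rw [← hY'img, card_image_of_injective _ Subtype.val_injective]
  have hdY : Real.exp (-(c₁ * dq n)) ≤ (Y'.card : ℝ) / (Fintype.card (PMatch n) : ℝ) := by
    rw [hY'card, ← hcardA, le_div_iff₀ hApos]
    have h1 : ν * #𝒜 ≤ 2 * #𝒢 := by
      calc ν * #𝒜 ≤ wmass zx ℱ := by rw [hmass, hcardA]; exact hzm
        _ ≤ 2 * #𝒢 := h𝒢mass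
    calc Real.exp (-(c₁ * dq n)) * #𝒜 ≤ ν / 2 * #𝒜 := mul_le_mul_of_nonneg_right hν2 hApos.le
      _ ≤ #𝒢 := by linarith
  -- (3) the set version
  obtain ⟨U, hU, M, hM, hUM⟩ := hS n t hN₁ hev hto h5 h5' X hXt Y' (by rw [hY'img]; exact h𝒢hom) hdX hdY
  refine ⟨U, M, hUM, (mem_filter.1 hU).2, ?_⟩
  have hMG : M.1 ∈ 𝒢 := (mem_filter.1 hM).2
  have := h𝒢pos M.1 hMG
  simp only [hzx_def, M.2, dif_pos] at this
  exact this

/-! ### §3 The sub-weight form -/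

/-- **(SNT-q)_w, sub-weight form** (the hypothesis `hSNT` of `…GeneralPositionBudget` / `…KernelPileUp`, eng g13). Under `GlobalLevelDInequality`,
for `τ ≥ 1` there are `c₀ > 0`, `n₁` with: for even `n ≥ n₁`, odd balanced `t`, `ε, ν ≥ exp(−c₀ dq n)`, a cut weight `x : OddSet n → [0,1]`
vanishing off the `t`-cuts and a matching weight `z : PM_n → [0,1]` that is `(PM_n, τ)`-homogeneous of mass `≥ ν·#PM_n`, EVERY sub-weight
`0 ≤ x' ≤ x` of mass `≥ ε·#t-cuts` and EVERY sub-weight `0 ≤ z' ≤ z` carrying at least half of `z` have an active tight pair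
(`z'` is `(PM_n, 2τ)`-homogeneous by brick 59, then §2 at parameter `2τ`). [cite: KeevashLifshitz2023, Thm. 1.8] [cite: KupavskiiZakharov2022, §2] -/
theorem weightedSNT_subweights_of_globalLevelD (hKL : GlobalLevelDInequality) {τ : ℝ} (hτ : 1 ≤ τ) :
    ∃ c₀ : ℝ, 0 < c₀ ∧ ∃ n₁ : ℕ, ∀ (n t : ℕ), n₁ ≤ n → Even n → Odd t → n ≤ 5 * t → n ≤ 5 * (n - t) →
      ∀ (ε ν : ℝ), Real.exp (-(c₀ * dq n)) ≤ ε → Real.exp (-(c₀ * dq n)) ≤ ν →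
      ∀ (x : OddSet n → ℝ) (z : PMatch n → ℝ), (∀ U, 0 ≤ x U ∧ x U ≤ 1) → (∀ U, U.1.card ≠ t → x U = 0) →
      (∀ M, 0 ≤ z M ∧ z M ≤ 1) →
      IsRelHomogeneousW τ (perfectMatchings (univ : Finset (Fin n)))
        (fun M : Finset (Sym2 (Fin n)) => if hM : IsPMOn (univ : Finset (Fin n)) M then z ⟨M, hM⟩ else 0)
        ((univ : Finset (PMatch n)).image Subtype.val) →
      ν * (Fintype.card (PMatch n) : ℝ) ≤ ∑ M, z M →
      ∀ x' : OddSet n → ℝ, (∀ U, 0 ≤ x' U ∧ x' U ≤ x U) →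
        ε * ((univ.filter fun U : OddSet n => U.1.card = t).card : ℝ) ≤ ∑ U, x' U →
      ∀ z' : PMatch n → ℝ, (∀ M, 0 ≤ z' M ∧ z' M ≤ z M) → ∑ M, z M ≤ 2 * ∑ M, z' M →
        ∃ U M, cc U M = 1 ∧ 0 < x' U ∧ 0 < z' M := by
  classical
  obtain ⟨c₁, hc₁, N₁, hS⟩ := weightedSNT_of_globalLevelD hKL (by linarith : (2 : ℝ) ≤ 2 * τ)
  obtain ⟨N₂, hN₂⟩ := two_mul_exp_le_exp_half hc₁
  refine ⟨c₁ / 2, by positivity, max N₁ N₂, ?_⟩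
  intro n t hn hev hto h5 h5' ε ν hε hν x z hx hxt hz hzh hzm x' hx' hx'm z' hz' hz'm
  have hN₁ : N₁ ≤ n := le_trans (le_max_left _ _) hn
  have hN₂n : N₂ ≤ n := le_trans (le_max_right _ _) hn
  have hdq0 : (0 : ℝ) ≤ dq n := Nat.cast_nonneg _
  have hmono : Real.exp (-(c₁ * dq n)) ≤ Real.exp (-(c₁ / 2 * dq n)) := Real.exp_le_exp.2 (by nlinarith)
  have hε' : Real.exp (-(c₁ * dq n)) ≤ ε := hmono.trans hε
  have hν' : Real.exp (-(c₁ * dq n)) ≤ ν / 2 := by have := hN₂ n hN₂n; linarith [hmono.trans hν]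
  -- the sub-weights satisfy the hypotheses of §2 at parameter `2τ` and thresholds `(ε, ν/2)`
  have hx'01 : ∀ U, 0 ≤ x' U ∧ x' U ≤ 1 := fun U => ⟨(hx' U).1, (hx' U).2.trans (hx U).2⟩
  have hx't : ∀ U, U.1.card ≠ t → x' U = 0 := fun U hU =>
    le_antisymm ((hx' U).2.trans (hxt U hU).le) (hx' U).1
  have hz'01 : ∀ M, 0 ≤ z' M ∧ z' M ≤ 1 := fun M => ⟨(hz' M).1, (hz' M).2.trans (hz M).2⟩
  have hz'd : ν / 2 * (Fintype.card (PMatch n) : ℝ) ≤ ∑ M, z' M := by linarith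
  have hz'h : IsRelHomogeneousW (2 * τ) (perfectMatchings (univ : Finset (Fin n)))
      (fun M : Finset (Sym2 (Fin n)) => if hM : IsPMOn (univ : Finset (Fin n)) M then z' ⟨M, hM⟩ else 0)
      ((univ : Finset (PMatch n)).image Subtype.val) := by
    refine isRelHomogeneousW_of_le_of_half hτ hzh ?_ ?_ ?_
    · intro A
      by_cases hA : IsPMOn (univ : Finset (Fin n)) A
      · simp only [hA, dif_pos]; exact (hz' _).1
      · simp only [hA, dif_neg, not_false_eq_true, le_refl]
    · intro A
      by_cases hA : IsPMOn (univ : Finset (Fin n)) A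
      · simp only [hA, dif_pos]; exact (hz' _).2
      · simp only [hA, dif_neg, not_false_eq_true, le_refl]
    · rw [wmass_ext_eq_sum, wmass_ext_eq_sum]; exact hz'm
  exact hS n t hN₁ hev hto h5 h5' ε (ν / 2) hε' hν' x' z' hx'01 hx't hx'm hz'01 hz'h hz'd

/-! ### §4 The `r = 2` dense cell, now modulo `GlobalLevelDInequality` only -/

/-- **THE `r = 2` DENSE NON-CROSSING PSD CELL WITHOUT A NET, mod Keevash–Lifshitz Thm 1.8** (brick 63 with `hSNTw` discharged by §2 at
`τ = 4e`). Assume `GlobalLevelDInequality`. There are `c₀ > 0`, `n₁` such that for every even `n ≥ n₁`, odd `t` with `n ≤ 5t`, `n ≤ 5(n−t)`,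
thresholds `ε, ν ≥ exp(−c₀·dq n)`, every level weight `W = levelWeight n t C w` with `Σ|w_c| ≤ B_v` satisfying the `r = 1` rung
`TracialValueLEAt W γ 1`, and every tight-orthogonal psd rectangle `(X, Y)` of dimension `2` supported on the `t`-cuts whose matching trace
weight `tr(Y_M)/2` is `(PM_n, e)`-homogeneous with `Σ_M tr(Y_M)/2 ≥ 4ν·#PM_n`:  `Σ_U Σ_M W(U,M)·tr(X_U Y_M) ≤ 6γ + 4·B_v·ε`.
[cite: KeevashLifshitz2023, Thm. 1.8] [cite: KupavskiiZakharov2022, §2] [cite: Rothvoss2017, §2 (PDF p. 6)] -/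
theorem denseCell_dim_two_of_globalLevelD (hKL : GlobalLevelDInequality) :
    ∃ c₀ : ℝ, 0 < c₀ ∧ ∃ n₁ : ℕ, ∀ (n t : ℕ), n₁ ≤ n → Even n → Odd t → n ≤ 5 * t → n ≤ 5 * (n - t) →
      ∀ (C : Finset ℕ) (w : ℕ → ℝ) (Bv γ ε ν : ℝ), ∑ c ∈ C, |w c| ≤ Bv →
      Real.exp (-(c₀ * dq n)) ≤ ε → Real.exp (-(c₀ * dq n)) ≤ ν →
      TracialValueLEAt (levelWeight n t C w) γ 1 →
      ∀ (X : OddSet n → Matrix (Fin 2) (Fin 2) ℝ) (Y : PMatch n → Matrix (Fin 2) (Fin 2) ℝ), IsPsdRect X Y →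
      (∀ U, U.1.card ≠ t → X U = 0) →
      IsRelHomogeneousW (Real.exp 1) (perfectMatchings (univ : Finset (Fin n)))
        (fun M : Finset (Sym2 (Fin n)) => if hM : IsPMOn (univ : Finset (Fin n)) M then (Y ⟨M, hM⟩).trace / 2 else 0)
        ((univ : Finset (PMatch n)).image Subtype.val) →
      4 * (ν * (Fintype.card (PMatch n) : ℝ)) ≤ ∑ M, (Y M).trace / 2 →
      ∑ U, ∑ M, levelWeight n t C w U M * (X U * Y M).trace ≤ 6 * γ + 4 * Bv * ε := by
  have h4e : (2 : ℝ) ≤ 4 * Real.exp 1 := by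
    have := Real.add_one_le_exp (1 : ℝ); linarith
  obtain ⟨c₀, hc₀, n₁, hS⟩ := weightedSNT_of_globalLevelD hKL h4e
  refine ⟨c₀, hc₀, n₁, ?_⟩
  intro n t hn hev hto h5 h5' C w Bv γ ε ν hBv hε hν hγ X Y hXY hXt hYhom hνY
  have hε0 : 0 < ε := lt_of_lt_of_le (Real.exp_pos _) hε
  exact denseCell_dim_two_of_homogeneous C w hBv hε0 hγ hXY hXt hYhom hνY
    fun x z hx hxt hxm hz hzh hzm => hS n t hn hev hto h5 h5' ε ν hε hν x z hx hxt hxm hz hzh hzm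

end Summit.PneNP.PneNP.Theorems.ChebyshevTracialDesignWeightedSNT
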